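import Literature.MathematicalPhysics.QuantumFieldTheory.Balaban1983to89.Node00.Record8
import Literature.MathematicalPhysics.QuantumFieldTheory.Balaban1983to89.Node00.N24KnitStage5C

/-!
# NODE N24 · binder B2 AT NODE 00's STAGE-8 RECORD `IsRecordOfRecord₈C` — WHERE THE β-FUNCTIONS ARE OBJECTS OF RECORD: the glue by name through the
# refinement `₈C → ₅C`, and the β-window binders READ AT THE β OF RECORD `betaOfRecord₈ θ` ([Balaban1987RG1] (1.20)–(1.22) p. 264 on the merged new term
# (1.6)), i.e. — on the binding world's own box — AT THE MERGED β `betaMerged …`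

TRACK A (YM-PLAN §2d, node N24 of 28), seat `pub-ymgap-dag-n24-a` (-a KNIT-BY-NAME: «keep the glue elaborating against the children's CURRENT statements of
record and the datum D₀ … report which child blocks»).  TENTH N24 module, a NEW importing one (append-only growth), over node00-def's Stage-8 record predicate
(`Node00.Record8`: `Stage8Params`, `betaOfRecord₈`, `residualOfStage8`, `IsRecordOfRecord₈C` with the γ-clause `0 < w.γ ∧ w.γ ≤ θ.γ`,
`isRecordOfRecord₅C_of_isRecordOfRecord₈C`, `βfun_stage8`).  Up to Stage 7 the record predicates were BLIND to the β-functions (`Residual₅.βfun` free), so N24's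
β-window entered as box bounds on an unconstrained `D.βfun`; at Stage 8 `D.βfun = betaOfRecord₈ θ = betaOfMerged βm (beta0OfMerged βm θ.v₀) θ.γ` with
`βm := betaMerged F (mergedTermFamilyMat F N (chi7 F N θ) θ.εbg) θ.ρ8 θ.bV` (def-B's `Node00.BackgroundActionOfRecord`, dag-n09-b's `Node00.BetaOfRecord`), and ON
every box `]0, γ']^{k+1}` with `γ' ≤ θ.γ` the β of record IS the merged β (`betaOfMerged_of_mem`, `FlowStep.box_mono`).  Hence, at a Stage-8 record, N24's two
β-binders become bounds on NODE O's object — the merged β of (1.22) — along the binding world's box `]0, w.γ]^{k+1}` (`w.γ ≤ θ.γ` is the record's clause):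
`BetaLowerH w.b w.γ βm` (asymptotic freedom `β ≥ b > 0` — UNPRINTED as such, census T09.F; NODE O ∕ (D1)(D4) roads) and `BetaUpperH w.βup w.γ βm` ([Balaban1987RG1]
p. 264, proof deferred there to the localized representation (1.7) ∕ [III] §3).  THEOREMS ONLY, def-free, sorry-free, standard axioms; nothing of node00-def's
redefined; chair R437 complied with (no (0.1) ∕ (2.50) FACE is typed over ₈C here — (B) is concluded for the datum `D.C` abstractly, exactly as at ₅C; the
densities' `rnDeriv` reading at ₇C∕₈C is untouched and the ₉C re-basing will be met by one more importing module of the same 30-line pattern).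

WHAT THIS FILE PROVES.
* §1 `N24_at_record₈C`, `…_of_prop26`, `N24_at_record₈C_knit₀₈₁₀₁₁₁₃` — the `₅C` theorems of modules 5 ∕ 9 VERBATIM at `₈C` through the refinement (β still at
  `D.βfun`; the knit's slots over `Stage5Params` exactly as the children display them — at `₈C` the record's Stage-5 view `θ.toStage5` is among those `θ`).
* §2 `N24_betaLowerH_iff_merged₈` ∕ `N24_betaUpperH_iff_merged₈` — at Stage-8 parameters `θ` with `D = datumOfRecord₅ (θ.toStage5)` and `γ' ≤ θ.γ`:
  `BetaLowerH b γ' D.βfun ↔ BetaLowerH b γ' βm` (same for the upper bound) — the kernel form of «at ₈ the β-binders are bounds on the merged β».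
  (Summits-side twin for an abstract `betaOfMerged`: `BalabanUVNodesN28AtBetaOfRecord.betaLowerH∕betaUpperH_betaOfMerged_iff`, dag-n28-a p412300 — not importable
  from Literature; here the two lines are re-derived AT THE RECORD from `betaOfMerged_of_mem` + `box_mono`.)
* §3 `N24_at_record₈C_of_betaOfRecord₈` (β-binders displayed at `betaOfRecord₈ θ` over the record's parameters, any `γ₀ ≥ w.γ`), **`N24_at_record₈C_of_betaMerged`**
  (γ₀ := w.γ: β-binders displayed at the MERGED β on the world's box), `N24_at_record₈C_knit_of_betaMerged` (the same with N08 ∕ N10 ∕ N11 ∕ N13 knit by name),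
  `N24_binders₈C_after_knit` (WHICH CHILD BLOCKS at ₈C in kernel form: five pure binders N05 N06 N07 N09 N12 ⇒ (B2), given N03's census, the four children's
  slots and the two merged-β bounds).
* §4 `N24_isRecordOfRecord₈C_reletter` — `₈C` is closed under the route's re-lettering of the world (γ lowered inside `]0, w.γ]`, `b`, `β⁺`, `e₋`, `e₊` free):
  the hypothesis `hRL` of the design-E faces of modules 5 ∕ 7 (`N24_at_datumE_of_refines₅C`, `N24_at_datumE_threshold_of_refines₅C`) at `Rec := IsRecordOfRecord₈C F N`,
  `hRec := isRecordOfRecord₅C_of_isRecordOfRecord₈C`.  VACUITY NOTE (unchanged from ₅C): the [B8]–[B16] carrier families are still FREE residual data at Stage 8, so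
  the per-record-universal child stubs N06 ∕ N08 remain refutable given their sisters (`B9LeafUnpinnedRecord5`, `B10LeafUnpinnedRecord5C` probes transport along
  the refinement's converse direction at the probe records) — the design-E face is therefore NOT instantiated at ₈C in this file; the per-record binder form (§1–§3)
  is the non-vacuous currency until the carrier-pinning stages.

WHICH CHILD BLOCKS at ₈C (2026-08-26T00:5xZ): THEOREMS — N01 N02 N04 N23, `hC`, `hγ`, guarded (0.20) (via `₅C`); BY NAME MODULO DISPLAYED SLOTS — N03 (Prop. 2.6
census), N08 (B10₅), N10 (B13₅), N11 ((P1₅) (P3₅) (S0) (S1)), N13 ((R₅) + five Cor.-3 leaves; residue = Stage ₉'s represented tower, R437); PURE BINDERS — N05 [B8],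
N06 [B9], N07 [B11], N09 [B12], N12 [B15]; β-SIDE — NOW TWO LOCATED BOUNDS ON THE MERGED β OF RECORD along `]0, w.γ]^{k+1}`: lower `b > 0` (UNPRINTED, T09.F;
NODE O), upper `β⁺` ([Balaban1987RG1] p. 264).  ETA(N24) = max(N13, NODE O's β-bounds, the carrier-pinning stages).
HONEST FRAMING: kernel bookkeeping BY NAME; every slot ∕ bound is a HYPOTHESIS displayed, nothing of Bałaban's asserted; N24 COMPOSITE — no discharge, no count;
one finite T⁴ programme at fixed ε; NOT continuum ∕ ℝ⁴ ∕ OS ∕ mass gap ∕ Clay.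
-/

noncomputable section

open scoped Matrix.Norms.L2Operator

namespace Literature.MathematicalPhysics.QuantumFieldTheory.Balaban1983to89.Node00

open DagBinding T4Continuum T4DatumAssembly FlowStepRuns AveragingRT

variable {F : T4Family} {N : ℕ} [NeZero N] {D : FiniteEpsData F (SU N)} {w : WorldP}

/-! ## §1. The `₅C` glue VERBATIM at `₈C` (refinement `isRecordOfRecord₅C_of_isRecordOfRecord₈C`) -/

/-- **N24 · (B2) at a Stage-8 record — the glue by name**: a `₈C` record `(D, w)`, `w.γ ≤ γ₀`, the ten open children at every run of `w` (N01 ∕ N02 ∕ N04 are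
theorems of the record), and the box bounds `w.b ≤ D.βfun ≤ w.βup` on `]0, γ₀]^{k+1}` give `B16.EndStatementBPrinted D.C` — `N24_at_record₅C` along the refinement.
[cite: Balaban1989LargeFieldII, Thm 1 p.355 + p.391; Balaban1988Convergent, Cor. 3 (2.50) p.264; Balaban1987RG1, (1.22) p.264 (bookkeeping over the Stage-8 record)] -/
theorem N24_at_record₈C (h : IsRecordOfRecord₈C F N D w) {γ₀ : ℝ} (hγ₀ : w.γ ≤ γ₀)
    (h03 : ∀ P : B12.RunParams, Dag.B6_main (leavesP w P)) (h05 : ∀ P : B12.RunParams, Dag.B8_main (leavesP w P))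
    (h06 : ∀ P : B12.RunParams, Dag.B9_main (leavesP w P)) (h07 : ∀ P : B12.RunParams, Dag.B11_main (leavesP w P))
    (h08 : ∀ P : B12.RunParams, Dag.B10_main (leavesP w P)) (h09 : ∀ P : B12.RunParams, Dag.B12_main (leavesP w P))
    (h10 : ∀ P : B12.RunParams, Dag.B13_main (leavesP w P)) (h11 : ∀ P : B12.RunParams, Dag.B14_main (leavesP w P))
    (h12 : ∀ P : B12.RunParams, Dag.B15_main (leavesP w P)) (h13 : ∀ P : B12.RunParams, Dag.B16_main (leavesP w P))
    (hlo : FlowStep.BetaLowerH w.b γ₀ D.βfun) (hhi : FlowStep.BetaUpperH w.βup γ₀ D.βfun) :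
    B16.EndStatementBPrinted D.C :=
  N24_at_record₅C (isRecordOfRecord₅C_of_isRecordOfRecord₈C h) hγ₀ h03 h05 h06 h07 h08 h09 h10 h11 h12 h13 hlo hhi

/-- The same with N03 at its statement of record (the [Balaban1984PropagatorsII] Prop. 2.6 census). [cite: Balaban1989LargeFieldII, Thm 1 p.355 + p.391; Balaban1984PropagatorsII, Prop. 2.6 (2.136)–(2.140) p.247 (bookkeeping)] -/
theorem N24_at_record₈C_of_prop26 (h : IsRecordOfRecord₈C F N D w) {γ₀ : ℝ} (hγ₀ : w.γ ≤ γ₀)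
    (h26 : ∀ θ : Stage3Params, θ.toStage1Params.Admissible →
      B6.Prop26Printed (fun i : B6KLevelCensusIndexV1.KIdx θ.d₆ θ.ℓ₆ θ.hd' θ.hL' θ.b₀ θ.b₁ => B6KLevelCensusIndexV1.kGeoG i)
        (fun i => B6Prop26Census2136KLevelV1.kG i))
    (h05 : ∀ P : B12.RunParams, Dag.B8_main (leavesP w P))
    (h06 : ∀ P : B12.RunParams, Dag.B9_main (leavesP w P)) (h07 : ∀ P : B12.RunParams, Dag.B11_main (leavesP w P))
    (h08 : ∀ P : B12.RunParams, Dag.B10_main (leavesP w P)) (h09 : ∀ P : B12.RunParams, Dag.B12_main (leavesP w P))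
    (h10 : ∀ P : B12.RunParams, Dag.B13_main (leavesP w P)) (h11 : ∀ P : B12.RunParams, Dag.B14_main (leavesP w P))
    (h12 : ∀ P : B12.RunParams, Dag.B15_main (leavesP w P)) (h13 : ∀ P : B12.RunParams, Dag.B16_main (leavesP w P))
    (hlo : FlowStep.BetaLowerH w.b γ₀ D.βfun) (hhi : FlowStep.BetaUpperH w.βup γ₀ D.βfun) :
    B16.EndStatementBPrinted D.C :=
  N24_at_record₅C_of_prop26 (isRecordOfRecord₅C_of_isRecordOfRecord₈C h) hγ₀ h26 h05 h06 h07 h08 h09 h10 h11 h12 h13 hlo hhi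

/-- **N24 at a Stage-8 record with N08, N10, N11, N13 KNIT BY NAME** — module 9's `N24_at_record₅C_knit₀₈₁₀₁₁₁₃` along the refinement; the four children's slots
are displayed over `Stage5Params` exactly as their seats state them (the record's Stage-5 view `θ.toStage5` is one of those parameters).
[cite: Balaban1989LargeFieldII, Thm 1 p.355 + pp.387, 391; Balaban1985UV3, Thm 1 p.257 + Thm 2 p.272; Balaban1988RG2Cluster, Lemmas 1–3 pp.9, 11, 20; Balaban1988Convergent, Thm 1 p.262, Theorem p.245, p.244, Cor. 3 (2.50) p.264 (bookkeeping)] -/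
theorem N24_at_record₈C_knit₀₈₁₀₁₁₁₃ (h : IsRecordOfRecord₈C F N D w) {γ₀ : ℝ} (hγ₀ : w.γ ≤ γ₀)
    (h03 : ∀ P : B12.RunParams, Dag.B6_main (leavesP w P)) (h05 : ∀ P : B12.RunParams, Dag.B8_main (leavesP w P))
    (h06 : ∀ P : B12.RunParams, Dag.B9_main (leavesP w P)) (h07 : ∀ P : B12.RunParams, Dag.B11_main (leavesP w P))
    (h09 : ∀ P : B12.RunParams, Dag.B12_main (leavesP w P)) (h12 : ∀ P : B12.RunParams, Dag.B15_main (leavesP w P))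
    (slots₀₈ : ∀ θ : Stage5Params F N, θ.Admissible → D = datumOfRecord₅ F N θ →
      (∀ P, w.up P = upOfRecord₅C F N θ P) → ∀ P : B12.RunParams,
        ∃ (Xc : PrintedCarriersR) (I : Type) (C : B10Assembly.Consts) (T : I → B10.TowerRun),
          Nonempty (∀ i, B10Assembly.LeafSystem C (T i)) ∧ θ.res.X P = Xc.withTowerRuns10 T)
    (slots₁₀ : ∀ θ : Stage5Params F N, θ.Admissible → D = datumOfRecord₅ F N θ →
      (∀ P, w.up P = upOfRecord₅C F N θ P) → ∀ P : B12.RunParams,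
        B9LeafX (θ.res.Y P) →
          (B10.Thm1PrintedCompact (θ.res.X P).runs10 ∧ B10.Thm2Printed (θ.res.X P).runs10) →
            B11Leaf (θ.res.Z P) → B12Sec2to5.Lemma4Printed (θ.res.X P).F12 (θ.res.X P).c12 →
              B13.Lemma1Printed (θ.res.X P).S13 (θ.res.X P).c13 ∧ B13.Lemma2Printed (θ.res.X P).S13 (θ.res.X P).c13 ∧
                B13.Lemma3Printed (θ.res.X P).S13 (θ.res.X P).c13)
    (slots₁₁ : ∀ θ : Stage5Params F N, θ.Admissible → D = datumOfRecord₅ F N θ →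
      (∀ P, w.up P = upOfRecord₅C F N θ P) → ∀ P : B12.RunParams,
        ∃ S Scorr : (k : ℕ) → Density (F.P P.K) k (SU N) → Prop,
          (ROpLeaf (θ.res.V P) → B14.RAssumedP244 (θ.res.R P) Scorr S P.K) ∧
          (∀ k, k ≤ P.K → S k (densOfRecord₅ F N θ P k) → θ.res.S218 P k (densOfRecord₅ F N θ P k)) ∧
          ((leavesP w P).smallCouplings → S 0 (rhoZeroOfRecord F N P.K P.g0 (θ.res.E P))) ∧
          ((leavesP w P).b7 → (leavesP w P).b8 → (leavesP w P).b9 → (leavesP w P).b10 → (leavesP w P).b11 →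
            (leavesP w P).smallCouplings → (leavesP w P).smallFieldInductive → (leavesP w P).flowControl →
              ∀ k, k < P.K → S k (densOfRecord₅ F N θ P k) →
                Scorr (k + 1) (TrhoOfRecord F N P.K k (densOfRecord₅ F N θ P k))))
    (eM eP : FiniteEpsData F (SU N) → ℝ → ℝ)
    (hR : ∀ θ : Stage5Params F N, θ.Admissible → D = datumOfRecord₅ F N θ → ∀ P : B12.RunParams, ROpLeaf (θ.res.V P))
    (hcor : ∀ θ : Stage5Params F N, θ.Admissible → D = datumOfRecord₅ F N θ →
      ∃ R : B14Cor3.ReprFamily (datumOfRecord₅ F N θ).C,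
        B14Cor3.LeafH (datumOfRecord₅ F N θ).C R w.γ ∧ B14Cor3.LeafU1 (datumOfRecord₅ F N θ).C R w.γ ∧
        B14Cor3.LeafU2 (datumOfRecord₅ F N θ).C R w.γ (eP D) ∧ B14Cor3.LeafL1 (datumOfRecord₅ F N θ).C R w.γ ∧
        B14Cor3.LeafL2 (datumOfRecord₅ F N θ).C R w.γ (eM D))
    (hlo : FlowStep.BetaLowerH w.b γ₀ D.βfun) (hhi : FlowStep.BetaUpperH w.βup γ₀ D.βfun) :
    B16.EndStatementBPrinted D.C :=
  N24_at_record₅C_knit₀₈₁₀₁₁₁₃ (isRecordOfRecord₅C_of_isRecordOfRecord₈C h) hγ₀ h03 h05 h06 h07 h09 h12 slots₀₈ slots₁₀ slots₁₁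
    eM eP hR hcor hlo hhi

/-! ## §2. At Stage 8 the β-binders are bounds on the MERGED β (the β of record IS the merged β on every box inside the record box) -/

/-- **The lower β-box bound at a Stage-8 datum IS a lower bound on the merged β** on every box `]0, γ']^{k+1}` with `γ' ≤ θ.γ`: `D.βfun = betaOfRecord₈ θ`
(`βfun_stage8`) `= betaOfMerged βm β⁰ θ.γ`, equal to `βm` on `Box θ.γ k ⊇ Box γ' k` (`betaOfMerged_of_mem`, `FlowStep.box_mono`).
[cite: Balaban1987RG1, (1.20)–(1.22) p.264 and (2.12)–(2.14) p.268 (the β of record vs the merged β; bookkeeping)] -/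
theorem N24_betaLowerH_iff_merged₈ (θ : Stage8Params F N) (hD : D = datumOfRecord₅ F N (θ.toStage5 F N)) {γ' b : ℝ} (hγ' : γ' ≤ θ.γ) :
    FlowStep.BetaLowerH b γ' D.βfun ↔
      (letI := θ.instVβ₁; letI := θ.instVβ₂; letI := θ.instιβ
       FlowStep.BetaLowerH b γ' (betaMerged F (mergedTermFamilyMat F N (chi7 F N θ) θ.εbg) θ.ρ8 θ.bV)) := by
  have hβ : D.βfun = betaOfRecord₈ F N θ := by rw [hD]; exact βfun_stage8 F N θ
  rw [hβ]
  unfold betaOfRecord₈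
  refine ⟨fun h k v hv => ?_, fun h k v hv => ?_⟩
  · have h' := h k v hv
    rw [betaOfMerged_of_mem _ _ _ (FlowStep.box_mono hγ' k hv)] at h'
    exact h'
  · rw [betaOfMerged_of_mem _ _ _ (FlowStep.box_mono hγ' k hv)]
    exact h k v hv

/-- **The upper β-box bound at a Stage-8 datum IS an upper bound on the merged β** on every box `]0, γ']^{k+1}` with `γ' ≤ θ.γ`.
[cite: Balaban1987RG1, (1.20)–(1.22) p.264 and (2.12)–(2.14) p.268 (bookkeeping)] -/
theorem N24_betaUpperH_iff_merged₈ (θ : Stage8Params F N) (hD : D = datumOfRecord₅ F N (θ.toStage5 F N)) {γ' β' : ℝ} (hγ' : γ' ≤ θ.γ) :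
    FlowStep.BetaUpperH β' γ' D.βfun ↔
      (letI := θ.instVβ₁; letI := θ.instVβ₂; letI := θ.instιβ
       FlowStep.BetaUpperH β' γ' (betaMerged F (mergedTermFamilyMat F N (chi7 F N θ) θ.εbg) θ.ρ8 θ.bV)) := by
  have hβ : D.βfun = betaOfRecord₈ F N θ := by rw [hD]; exact βfun_stage8 F N θ
  rw [hβ]
  unfold betaOfRecord₈
  refine ⟨fun h k v hv => ?_, fun h k v hv => ?_⟩
  · have h' := h k v hv
    rw [betaOfMerged_of_mem _ _ _ (FlowStep.box_mono hγ' k hv)] at h'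
    exact h'
  · rw [betaOfMerged_of_mem _ _ _ (FlowStep.box_mono hγ' k hv)]
    exact h k v hv

/-! ## §3. (B2) at a Stage-8 record with the β-binders READ AT THE β OF RECORD ∕ AT THE MERGED β -/

/-- **N24 at a Stage-8 record, β-binders displayed AT THE β OF RECORD `betaOfRecord₈ θ`** over the record's parameters (every admissible `θ : Stage8Params` with
`D = datumOfRecord₅ (θ.toStage5)` and `w.γ ≤ θ.γ`), any `γ₀ ≥ w.γ`; children as by-name binders at the record world. [cite: Balaban1989LargeFieldII, Thm 1 p.355 + p.391; Balaban1987RG1, (1.20)–(1.22) p.264 (bookkeeping over the Stage-8 record)] -/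
theorem N24_at_record₈C_of_betaOfRecord₈ (h : IsRecordOfRecord₈C F N D w) {γ₀ : ℝ} (hγ₀ : w.γ ≤ γ₀)
    (h03 : ∀ P : B12.RunParams, Dag.B6_main (leavesP w P)) (h05 : ∀ P : B12.RunParams, Dag.B8_main (leavesP w P))
    (h06 : ∀ P : B12.RunParams, Dag.B9_main (leavesP w P)) (h07 : ∀ P : B12.RunParams, Dag.B11_main (leavesP w P))
    (h08 : ∀ P : B12.RunParams, Dag.B10_main (leavesP w P)) (h09 : ∀ P : B12.RunParams, Dag.B12_main (leavesP w P))
    (h10 : ∀ P : B12.RunParams, Dag.B13_main (leavesP w P)) (h11 : ∀ P : B12.RunParams, Dag.B14_main (leavesP w P))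
    (h12 : ∀ P : B12.RunParams, Dag.B15_main (leavesP w P)) (h13 : ∀ P : B12.RunParams, Dag.B16_main (leavesP w P))
    (hβ : ∀ θ : Stage8Params F N, θ.Admissible → D = datumOfRecord₅ F N (θ.toStage5 F N) → w.γ ≤ θ.γ →
      FlowStep.BetaLowerH w.b γ₀ (betaOfRecord₈ F N θ) ∧ FlowStep.BetaUpperH w.βup γ₀ (betaOfRecord₈ F N θ)) :
    B16.EndStatementBPrinted D.C := by
  obtain ⟨θ, hθ, hD, -, hγ, -, -⟩ := id h
  obtain ⟨hlo, hhi⟩ := hβ θ hθ hD hγ.2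
  have hβfun : D.βfun = betaOfRecord₈ F N θ := by rw [hD]; exact βfun_stage8 F N θ
  exact N24_at_record₈C h hγ₀ h03 h05 h06 h07 h08 h09 h10 h11 h12 h13 (hβfun ▸ hlo) (hβfun ▸ hhi)

/-- **N24 at a Stage-8 record, β-binders displayed AT THE MERGED β `betaMerged …` ON THE BINDING WORLD'S BOX `]0, w.γ]^{k+1}`** (γ₀ := w.γ; the record's clause
`w.γ ≤ θ.γ` puts the world's box inside the record box, where the β of record is the merged β): children as by-name binders at the record world + a LOWER bound
`w.b` and an UPPER bound `w.βup` on the merged β of [Balaban1987RG1] (1.22) along the world's box, over the record's parameters ⇒ `B16.EndStatementBPrinted D.C`.  The two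
bounds are NODE O's ∕ [I] p. 264's — displayed, not asserted. [cite: Balaban1989LargeFieldII, Thm 1 p.355 + p.391; Balaban1987RG1, (1.20)–(1.22) p.264, (2.12)–(2.14) p.268; Balaban1988Convergent, Cor. 3 (2.50) p.264 (bookkeeping over the Stage-8 record)] -/
theorem N24_at_record₈C_of_betaMerged (h : IsRecordOfRecord₈C F N D w)
    (h03 : ∀ P : B12.RunParams, Dag.B6_main (leavesP w P)) (h05 : ∀ P : B12.RunParams, Dag.B8_main (leavesP w P))
    (h06 : ∀ P : B12.RunParams, Dag.B9_main (leavesP w P)) (h07 : ∀ P : B12.RunParams, Dag.B11_main (leavesP w P))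
    (h08 : ∀ P : B12.RunParams, Dag.B10_main (leavesP w P)) (h09 : ∀ P : B12.RunParams, Dag.B12_main (leavesP w P))
    (h10 : ∀ P : B12.RunParams, Dag.B13_main (leavesP w P)) (h11 : ∀ P : B12.RunParams, Dag.B14_main (leavesP w P))
    (h12 : ∀ P : B12.RunParams, Dag.B15_main (leavesP w P)) (h13 : ∀ P : B12.RunParams, Dag.B16_main (leavesP w P))
    (hβm : ∀ θ : Stage8Params F N, θ.Admissible → D = datumOfRecord₅ F N (θ.toStage5 F N) → w.γ ≤ θ.γ →
      letI := θ.instVβ₁; letI := θ.instVβ₂; letI := θ.instιβ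
      FlowStep.BetaLowerH w.b w.γ (betaMerged F (mergedTermFamilyMat F N (chi7 F N θ) θ.εbg) θ.ρ8 θ.bV) ∧
        FlowStep.BetaUpperH w.βup w.γ (betaMerged F (mergedTermFamilyMat F N (chi7 F N θ) θ.εbg) θ.ρ8 θ.bV)) :
    B16.EndStatementBPrinted D.C := by
  obtain ⟨θ, hθ, hD, -, hγ, -, -⟩ := id h
  obtain ⟨hlo, hhi⟩ := hβm θ hθ hD hγ.2
  exact N24_at_record₈C h le_rfl h03 h05 h06 h07 h08 h09 h10 h11 h12 h13 ((N24_betaLowerH_iff_merged₈ θ hD hγ.2).mpr hlo)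
    ((N24_betaUpperH_iff_merged₈ θ hD hγ.2).mpr hhi)

/-- **N24 at a Stage-8 record with N08 ∕ N10 ∕ N11 ∕ N13 knit by name AND the β-binders at the merged β** — §1's knit with γ₀ := w.γ and §2's readings.
[cite: Balaban1989LargeFieldII, Thm 1 p.355 + pp.387, 391; Balaban1987RG1, (1.20)–(1.22) p.264; Balaban1985UV3, Thm 1 p.257 + Thm 2 p.272; Balaban1988RG2Cluster, Lemmas 1–3 pp.9, 11, 20; Balaban1988Convergent, Thm 1 p.262, Cor. 3 (2.50) p.264 (bookkeeping)] -/
theorem N24_at_record₈C_knit_of_betaMerged (h : IsRecordOfRecord₈C F N D w)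
    (h03 : ∀ P : B12.RunParams, Dag.B6_main (leavesP w P)) (h05 : ∀ P : B12.RunParams, Dag.B8_main (leavesP w P))
    (h06 : ∀ P : B12.RunParams, Dag.B9_main (leavesP w P)) (h07 : ∀ P : B12.RunParams, Dag.B11_main (leavesP w P))
    (h09 : ∀ P : B12.RunParams, Dag.B12_main (leavesP w P)) (h12 : ∀ P : B12.RunParams, Dag.B15_main (leavesP w P))
    (slots₀₈ : ∀ θ : Stage5Params F N, θ.Admissible → D = datumOfRecord₅ F N θ →
      (∀ P, w.up P = upOfRecord₅C F N θ P) → ∀ P : B12.RunParams,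
        ∃ (Xc : PrintedCarriersR) (I : Type) (C : B10Assembly.Consts) (T : I → B10.TowerRun),
          Nonempty (∀ i, B10Assembly.LeafSystem C (T i)) ∧ θ.res.X P = Xc.withTowerRuns10 T)
    (slots₁₀ : ∀ θ : Stage5Params F N, θ.Admissible → D = datumOfRecord₅ F N θ →
      (∀ P, w.up P = upOfRecord₅C F N θ P) → ∀ P : B12.RunParams,
        B9LeafX (θ.res.Y P) →
          (B10.Thm1PrintedCompact (θ.res.X P).runs10 ∧ B10.Thm2Printed (θ.res.X P).runs10) →
            B11Leaf (θ.res.Z P) → B12Sec2to5.Lemma4Printed (θ.res.X P).F12 (θ.res.X P).c12 →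
              B13.Lemma1Printed (θ.res.X P).S13 (θ.res.X P).c13 ∧ B13.Lemma2Printed (θ.res.X P).S13 (θ.res.X P).c13 ∧
                B13.Lemma3Printed (θ.res.X P).S13 (θ.res.X P).c13)
    (slots₁₁ : ∀ θ : Stage5Params F N, θ.Admissible → D = datumOfRecord₅ F N θ →
      (∀ P, w.up P = upOfRecord₅C F N θ P) → ∀ P : B12.RunParams,
        ∃ S Scorr : (k : ℕ) → Density (F.P P.K) k (SU N) → Prop,
          (ROpLeaf (θ.res.V P) → B14.RAssumedP244 (θ.res.R P) Scorr S P.K) ∧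
          (∀ k, k ≤ P.K → S k (densOfRecord₅ F N θ P k) → θ.res.S218 P k (densOfRecord₅ F N θ P k)) ∧
          ((leavesP w P).smallCouplings → S 0 (rhoZeroOfRecord F N P.K P.g0 (θ.res.E P))) ∧
          ((leavesP w P).b7 → (leavesP w P).b8 → (leavesP w P).b9 → (leavesP w P).b10 → (leavesP w P).b11 →
            (leavesP w P).smallCouplings → (leavesP w P).smallFieldInductive → (leavesP w P).flowControl →
              ∀ k, k < P.K → S k (densOfRecord₅ F N θ P k) →
                Scorr (k + 1) (TrhoOfRecord F N P.K k (densOfRecord₅ F N θ P k))))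
    (eM eP : FiniteEpsData F (SU N) → ℝ → ℝ)
    (hR : ∀ θ : Stage5Params F N, θ.Admissible → D = datumOfRecord₅ F N θ → ∀ P : B12.RunParams, ROpLeaf (θ.res.V P))
    (hcor : ∀ θ : Stage5Params F N, θ.Admissible → D = datumOfRecord₅ F N θ →
      ∃ R : B14Cor3.ReprFamily (datumOfRecord₅ F N θ).C,
        B14Cor3.LeafH (datumOfRecord₅ F N θ).C R w.γ ∧ B14Cor3.LeafU1 (datumOfRecord₅ F N θ).C R w.γ ∧
        B14Cor3.LeafU2 (datumOfRecord₅ F N θ).C R w.γ (eP D) ∧ B14Cor3.LeafL1 (datumOfRecord₅ F N θ).C R w.γ ∧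
        B14Cor3.LeafL2 (datumOfRecord₅ F N θ).C R w.γ (eM D))
    (hβm : ∀ θ : Stage8Params F N, θ.Admissible → D = datumOfRecord₅ F N (θ.toStage5 F N) → w.γ ≤ θ.γ →
      letI := θ.instVβ₁; letI := θ.instVβ₂; letI := θ.instιβ
      FlowStep.BetaLowerH w.b w.γ (betaMerged F (mergedTermFamilyMat F N (chi7 F N θ) θ.εbg) θ.ρ8 θ.bV) ∧
        FlowStep.BetaUpperH w.βup w.γ (betaMerged F (mergedTermFamilyMat F N (chi7 F N θ) θ.εbg) θ.ρ8 θ.bV)) :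
    B16.EndStatementBPrinted D.C := by
  obtain ⟨θ, hθ, hD, -, hγ, -, -⟩ := id h
  obtain ⟨hlo, hhi⟩ := hβm θ hθ hD hγ.2
  exact N24_at_record₈C_knit₀₈₁₀₁₁₁₃ h le_rfl h03 h05 h06 h07 h09 h12 slots₀₈ slots₁₀ slots₁₁ eM eP hR hcor
    ((N24_betaLowerH_iff_merged₈ θ hD hγ.2).mpr hlo) ((N24_betaUpperH_iff_merged₈ θ hD hγ.2).mpr hhi)

/-- **WHICH CHILD BLOCKS at `₈C`, in kernel form**: the (B2) binder at a Stage-8 record is implied by the FIVE pure child binders N05 [B8], N06 [B9], N07 [B11],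
N09 [B12], N12 [B15] at the record world, given N03's census, N08 ∕ N10 ∕ N11 ∕ N13's displayed slots and the two bounds on the MERGED β of record along
`]0, w.γ]^{k+1}` — one implication, every antecedent displayed (nothing asserted). [cite: Balaban1989LargeFieldII, Thm 1 p.355 + p.391; Balaban1987RG1, (1.20)–(1.22) p.264 (bookkeeping: the residual binder list of N24 at Stage 8)] -/
theorem N24_binders₈C_after_knit (h : IsRecordOfRecord₈C F N D w)
    (h26 : ∀ θ : Stage3Params, θ.toStage1Params.Admissible →
      B6.Prop26Printed (fun i : B6KLevelCensusIndexV1.KIdx θ.d₆ θ.ℓ₆ θ.hd' θ.hL' θ.b₀ θ.b₁ => B6KLevelCensusIndexV1.kGeoG i)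
        (fun i => B6Prop26Census2136KLevelV1.kG i))
    (slots₀₈ : ∀ θ : Stage5Params F N, θ.Admissible → D = datumOfRecord₅ F N θ →
      (∀ P, w.up P = upOfRecord₅C F N θ P) → ∀ P : B12.RunParams,
        ∃ (Xc : PrintedCarriersR) (I : Type) (C : B10Assembly.Consts) (T : I → B10.TowerRun),
          Nonempty (∀ i, B10Assembly.LeafSystem C (T i)) ∧ θ.res.X P = Xc.withTowerRuns10 T)
    (slots₁₀ : ∀ θ : Stage5Params F N, θ.Admissible → D = datumOfRecord₅ F N θ →
      (∀ P, w.up P = upOfRecord₅C F N θ P) → ∀ P : B12.RunParams,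
        B9LeafX (θ.res.Y P) →
          (B10.Thm1PrintedCompact (θ.res.X P).runs10 ∧ B10.Thm2Printed (θ.res.X P).runs10) →
            B11Leaf (θ.res.Z P) → B12Sec2to5.Lemma4Printed (θ.res.X P).F12 (θ.res.X P).c12 →
              B13.Lemma1Printed (θ.res.X P).S13 (θ.res.X P).c13 ∧ B13.Lemma2Printed (θ.res.X P).S13 (θ.res.X P).c13 ∧
                B13.Lemma3Printed (θ.res.X P).S13 (θ.res.X P).c13)
    (slots₁₁ : ∀ θ : Stage5Params F N, θ.Admissible → D = datumOfRecord₅ F N θ →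
      (∀ P, w.up P = upOfRecord₅C F N θ P) → ∀ P : B12.RunParams,
        ∃ S Scorr : (k : ℕ) → Density (F.P P.K) k (SU N) → Prop,
          (ROpLeaf (θ.res.V P) → B14.RAssumedP244 (θ.res.R P) Scorr S P.K) ∧
          (∀ k, k ≤ P.K → S k (densOfRecord₅ F N θ P k) → θ.res.S218 P k (densOfRecord₅ F N θ P k)) ∧
          ((leavesP w P).smallCouplings → S 0 (rhoZeroOfRecord F N P.K P.g0 (θ.res.E P))) ∧
          ((leavesP w P).b7 → (leavesP w P).b8 → (leavesP w P).b9 → (leavesP w P).b10 → (leavesP w P).b11 →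
            (leavesP w P).smallCouplings → (leavesP w P).smallFieldInductive → (leavesP w P).flowControl →
              ∀ k, k < P.K → S k (densOfRecord₅ F N θ P k) →
                Scorr (k + 1) (TrhoOfRecord F N P.K k (densOfRecord₅ F N θ P k))))
    (eM eP : FiniteEpsData F (SU N) → ℝ → ℝ)
    (hR : ∀ θ : Stage5Params F N, θ.Admissible → D = datumOfRecord₅ F N θ → ∀ P : B12.RunParams, ROpLeaf (θ.res.V P))
    (hcor : ∀ θ : Stage5Params F N, θ.Admissible → D = datumOfRecord₅ F N θ →
      ∃ R : B14Cor3.ReprFamily (datumOfRecord₅ F N θ).C,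
        B14Cor3.LeafH (datumOfRecord₅ F N θ).C R w.γ ∧ B14Cor3.LeafU1 (datumOfRecord₅ F N θ).C R w.γ ∧
        B14Cor3.LeafU2 (datumOfRecord₅ F N θ).C R w.γ (eP D) ∧ B14Cor3.LeafL1 (datumOfRecord₅ F N θ).C R w.γ ∧
        B14Cor3.LeafL2 (datumOfRecord₅ F N θ).C R w.γ (eM D))
    (hβm : ∀ θ : Stage8Params F N, θ.Admissible → D = datumOfRecord₅ F N (θ.toStage5 F N) → w.γ ≤ θ.γ →
      letI := θ.instVβ₁; letI := θ.instVβ₂; letI := θ.instιβ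
      FlowStep.BetaLowerH w.b w.γ (betaMerged F (mergedTermFamilyMat F N (chi7 F N θ) θ.εbg) θ.ρ8 θ.bV) ∧
        FlowStep.BetaUpperH w.βup w.γ (betaMerged F (mergedTermFamilyMat F N (chi7 F N θ) θ.εbg) θ.ρ8 θ.bV)) :
    ((∀ P : B12.RunParams, Dag.B8_main (leavesP w P)) → (∀ P : B12.RunParams, Dag.B9_main (leavesP w P)) →
      (∀ P : B12.RunParams, Dag.B11_main (leavesP w P)) → (∀ P : B12.RunParams, Dag.B12_main (leavesP w P)) →
      (∀ P : B12.RunParams, Dag.B15_main (leavesP w P)) → B16.EndStatementBPrinted D.C) := by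
  intro h05 h06 h07 h09 h12
  obtain ⟨θ, hθ, hD, -, hγ, -, -⟩ := id h
  obtain ⟨hlo, hhi⟩ := hβm θ hθ hD hγ.2
  exact N24_at_record₅C_knit₀₈₁₀₁₁₁₃_of_prop26 (isRecordOfRecord₅C_of_isRecordOfRecord₈C h) le_rfl h26 h05 h06 h07 h09 h12
    slots₀₈ slots₁₀ slots₁₁ eM eP hR hcor ((N24_betaLowerH_iff_merged₈ θ hD hγ.2).mpr hlo)
    ((N24_betaUpperH_iff_merged₈ θ hD hγ.2).mpr hhi)

/-! ## §4. `₈C` is closed under the route's re-lettering of the world (the `hRL` of the design-E faces) -/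

/-- **Re-lettering a Stage-8 record**: lowering the world's `γ` inside `]0, w.γ]` and replacing its letters `b`, `β⁺`, `e₋`, `e₊` keeps `IsRecordOfRecord₈C` (the
predicate reads `C`, `γ` — through `0 < w.γ ∧ w.γ ≤ θ.γ` — `L` and `up` only; same parameters `θ`).  This is the closure hypothesis `hRL` of the design-E faces
`N24_at_datumE_of_refines₅C` ∕ `N24_at_datumE_threshold_of_refines₅C` at `Rec := IsRecordOfRecord₈C F N` (with `hRec := isRecordOfRecord₅C_of_isRecordOfRecord₈C`) —
NOT instantiated here: the carrier families are still free at Stage 8, so the per-record-universal stubs of N06 ∕ N08 stay refutable given their sisters (vacuity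
note of modules 4 ∕ 5 ∕ 7). [cite: Balaban1987RG1, (1.22) p.264 (bookkeeping: letters of the binding world vs the Stage-8 record)] -/
theorem N24_isRecordOfRecord₈C_reletter (h : IsRecordOfRecord₈C F N D w) {γ' b' : ℝ} (hγ' : 0 < γ') (hle : γ' ≤ w.γ) (hb' : 0 < b')
    (βup' : ℝ) (em ep : ℝ → ℝ) :
    IsRecordOfRecord₈C F N D { w with γ := γ', b := b', b_pos := hb', βup := βup', em := em, ep := ep } := by
  obtain ⟨θ, hθ, hD, hC, hγ, hL, hup⟩ := h
  exact ⟨θ, hθ, hD, hC, ⟨hγ', hle.trans hγ.2⟩, hL, hup⟩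

/-- In particular a Stage-8 record re-read with other exponent letters is a Stage-8 record (N13's ∃-exponent reading, module 4's pattern).
[cite: Balaban1989LargeFieldII, Thm 1 p.355 (bookkeeping)] -/
theorem N24_isRecordOfRecord₈C_withExp (h : IsRecordOfRecord₈C F N D w) (em ep : ℝ → ℝ) :
    IsRecordOfRecord₈C F N D { w with em := em, ep := ep } := by
  obtain ⟨θ, hθ, hD, hC, hγ, hL, hup⟩ := h
  exact ⟨θ, hθ, hD, hC, hγ, hL, hup⟩

end Literature.MathematicalPhysics.QuantumFieldTheory.Balaban1983to89.Node00

end
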